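import Literature.NumberTheory.EllipticCurves.Kato2004.ZetaLiftEulerSystemClassProofs
import Literature.NumberTheory.EllipticCurves.Kato2004.EulerSystemBoundFineSelmerTwo
import Literature.NumberTheory.EllipticCurves.Kato2004.ValueGuardSatisfiableProofs
import Literature.NumberTheory.EllipticCurves.KatoTwistedFinitenessEulerFactorsProofs
import Literature.NumberTheory.EllipticCurves.KatoTwistedFinitenessTrivialCharacterProofs
import Literature.NumberTheory.GaloisRepresentations.ContinuousCorestrictionComp
import HarnessLib

/-!
# Kato 2004 (Astérisque 295): hypothesis (i) of Thm. 13.4 is DISCHARGEABLE — a NON-ZERO genuine Λ-adic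
# Euler-system class exists in `𝐇¹_Γ(T_pW)` (`IsEulerSystemClass`, odd `p`) whenever `L(W,1) ≠ 0`, granted only
# Kato's construction (8.1.3)/Ex. 13.3/Thm. 9.7/Thm. 6.6 (1) (`exists_eulerSystem_expStar_values`); the value-side
# lemma (the bottom class `z_{0,∅} ≠ 0`) for EVERY `p` — THEOREMS (no definition, no named fact)

Topic `NumberTheory/EllipticCurves`, sub-directory `Kato2004` (namespace = path). THEOREMS ONLY (net debt 0): no
`def`, no named fact, no instance. Seat `bsd-wall-tp2-p2x-w2` (prover, cell `bsd-wall`, width seat on crux K3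
stmt-BirchSwinnertonDyer-20308 `SignedKatoDivisibilityUpToAtTwo` of routes `ThetaPartnerAtTwo` /
`ResidualThetaTransportAtTwo`). HONEST FRAMING: BSD is not proved by any of this; every theorem of §3 is CONDITIONAL
on Kato's construction fact `exists_eulerSystem_expStar_values` (def:Prop, no `_holds`) when that is displayed.

## Why (the binders it discharges)

Kato's Thm. 13.4 [p. 226] is an Euler-system bound under hypothesis (i) "`Z_q ≠ 0` for any prime ideal `q` of `Λ`
of height `0`", i.e. the Euler-system class is non-zero. The tree's transcriptions quantify over a GENUINE class
`s` with `s ≠ 0`: `thm13_4_lengthAt_fineSelmerDual_le_of_isEulerSystemClass` (odd `p`, class predicate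
`IsEulerSystemClass`), `thm13_4_two_lengthAt_fineSelmerDual_le_of_isEulerSystemClassTwo` (`p = 2`,
`IsEulerSystemClassTwo`), and the consumers carry the same binder: `hES : ∃ I s, IsEulerSystemClass W p κ γ I s ∧
s ≠ 0` in `fineSelmerDual_isTorsion_of_thm13_4_of_thm12_4_of_exists_isEulerSystemClass`, `(hs0 : s ≠ 0)` in the
`Summits`-side roads of cells `bsd-potss` (K8 19241) and `bsd-wall` (K3 20308, stubs (C2)/(K2) of line
`colemanrat`). This file DISCHARGES that binder from Kato's own zeta family: for every `W/ℚ` with `W[p]`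
irreducible, newform `f` and `L(W,1) ≠ 0` (analytic rank `0`), a non-zero genuine class exists in every pinned
`𝐇¹_Γ(T_pW)` (odd `p` here; the `p = 2` twin, same proof with `levelToLayerTwo`, is
`Summit.BirchSwinnertonDyer.BirchSwinnertonDyer.Theorems.SignedKatoOffTwo.ESClassTwo.exists_isEulerSystemClassTwo_ne_zero`
of `Summits/…/Theorems/ThetaPartnerAtTwoSignedKatoUpToAtTwoOffTwoESClass.lean`), granted only the construction
fact. In print this is Kato's
Thm. 12.5 (1) [pp. 221–222] ("`V(f) → 𝐇¹; γ ↦ z_γ` is injective") in the currency of the tree's value law.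

## The argument (tree theorems only)

* (value side, any `p`, §1) For a `ZetaBody W p f ι κ Λ c d a A z x` witness, (C4)+(C5) at the bottom level
  `m = 1` (trivial character) give `Λ_{0,∅}(z_{0,∅}) = 1 ⊗ r₀`, `r₀ = κ · L_{(pA)}(f,1)/Ω⁺_f · R⁻(c,d,a,A,d′)`
  (`zetaBody_value_level_one`); `L_{(pA)}(f,1) ≠ 0` when `L(W,1) ≠ 0` since the removed Euler factors do not
  vanish at `1` (`exists_continuation_changeLevel_of`, `eulerFactors_one_ne_zero`); `Ω⁺_f > 0`
  (`IsNewform0.plusPeriod_pos_holds`); the four-cusp factor `R⁻ ≠ 0` is the VALUE GUARD, satisfiable by Kato's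
  admissible choice (`valueGuard_satisfiable`: `c = 1 + 6pA`, `d = 1 + 6pAN`, a cusp with `[a/A]⁻_f ≠ 0`). Hence
  `z_{0,∅} ≠ 0` (`zetaBody_bottom_ne_zero`; `y ↦ 1 ⊗ y` is injective).
* (Euler-system side, §2) `Cor_{ℚ(μ_{p^k})/ℚ}(z_{k,∅}) = z_{0,∅}` (`IsEulerSystem.cores_p`, no Euler factor in
  the `p`-direction) and transitivity of corestriction (`coresLe_comp`) through `ℚ_0 = ℚ`
  (`coresLe_level_ne_zero`, any `p`, any level `k`): the layer-`0` component `Cor_{ℚ(μ_p)/ℚ_0}(z_{1,∅})` of the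
  Λ-adic lift (odd `p`, `levelToLayer`) is non-zero, so the lift is (`lift_ne_zero_of_bottom_ne_zero`).
* (§3) the lift exists and is a genuine class (`exists_isEulerSystemClass_of_zetaBody`):
  `exists_isEulerSystemClass_ne_zero_of_zetaBody` (from a guarded witness) and `exists_isEulerSystemClass_ne_zero`
  (from the construction fact, via `valueGuard_satisfiable`).
* §0: `ℚ(ζ_1) = ℚ` bookkeeping (`cycLevel p 0 ∅ = 1`, rationality of elements of `ℚ(ζ_1)`, the one-term
  character sum, the trivial character of level `1`).

## Source (K. Kato, Astérisque 295 (2004) [Kato2004Asterisque]; held copy `paper:doi-10-24033-ast-639`)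

Thm. 12.5 (1) [pp. 221–222]: "a unique `F_λ`-linear map `V_{F_λ}(f) → 𝐇¹(V_{F_λ}(f)); γ ↦ z_γ^{(p)}` …";
Thm. 13.4 [p. 226]: "Assume the following (i)–(v). (i) `Z_q ≠ 0` for any prime ideal `q` of `Λ` of height `0`."
Prop. 13.7 [p. 227]: "`Z_q ≠ 0` for any prime ideal `q` of `Λ` of height `0`" (for Kato's `Z`, via 12.5);
13.9 [p. 229]: "Fix … such that `δ(f, j₁, α₁)⁺ ≠ 0`"; Ex. 13.3 [p. 225] (the guards `(c, 6pA) = (d, 6pN) = 1`);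
Thm. 9.7 [p. 189] and Thm. 6.6 (1) [p. 163] (the value law (C5) of `ZetaBody`). Nothing beyond these readings
(already of record in `EulerSystemValues.lean`, `ValueGuardSatisfiableProofs.lean`) is used.

References: [Kato2004Asterisque] as above and §13.1 (13.1.1), §13.8 (p. 228); [Rubin2000] Def. 2.1.1;
[Washington1997] §13.1 (`ℚ_n ⊂ ℚ(μ_{2^{n+2}})`); [MazurTateTeitelbaum1986Invent] §I.8; [BirchSwinnertonDyer1965].
-/

set_option autoImplicit false

noncomputable section

open scoped NumberField TensorProduct MatrixGroups
open Field IsDedekindDomain CongruenceSubgroup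
open Literature.NumberTheory.GaloisRepresentations
open Literature.NumberTheory.EllipticCurves Literature.NumberTheory.EllipticCurves.ModularForms
open Literature.NumberTheory.EllipticCurves.Kato2004.EulerSystemValues Rat.HeightOneSpectrum

namespace Literature.NumberTheory.EllipticCurves.Kato2004

/-! ## §0 Level one: `ℚ(ζ_1) = ℚ`, the trivial character, the one-term character sum -/

namespace EulerSystemValues

/-- The bottom cyclotomic level is `m(0, ∅) = 1`. [folklore] -/
private theorem cycLevel_zero_empty (p : ℕ) : cycLevel p 0 ∅ = 1 := by
  simp [cycLevel]

set_option backward.isDefEq.respectTransparency false in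
/-- Every element of `ℚ(ζ_1)` is rational (`[ℚ(ζ_m) : ℚ] = φ(m)`, `φ(1) = 1`). [folklore] -/
private theorem exists_algebraMap_eq_of_level_one {m : ℕ} [NeZero m] (hm : m = 1)
    (y : CyclotomicField m ℚ) : ∃ r : ℚ, algebraMap ℚ (CyclotomicField m ℚ) r = y := by
  have hfin : Module.finrank ℚ (CyclotomicField m ℚ) = 1 := by
    rw [IsCyclotomicExtension.finrank (CyclotomicField m ℚ)
      (Polynomial.cyclotomic.irreducible_rat (NeZero.pos m)), hm, Nat.totient_one]
  have hy : y ∈ (⊥ : Subalgebra ℚ (CyclotomicField m ℚ)) := by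
    rw [Subalgebra.bot_eq_top_of_finrank_eq_one hfin]
    exact Algebra.mem_top
  exact Algebra.mem_bot.mp hy

/-- A ring homomorphism `ℚ(ζ_m) → ℂ` restricts to the canonical map on `ℚ`. [folklore] -/
private theorem ringHom_algebraMap_ratCast {m : ℕ} [NeZero m] (ι : CyclotomicField m ℚ →+* ℂ) (r : ℚ) :
    ι (algebraMap ℚ (CyclotomicField m ℚ) r) = (r : ℂ) := by
  rw [← RingHom.comp_apply]
  exact congrFun (congrArg DFunLike.coe (Subsingleton.elim (ι.comp (algebraMap ℚ _)) (Rat.castHom ℂ))) r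

set_option backward.isDefEq.respectTransparency false in
/-- At level `m = 1` Kato's character sum `Σ_b χ(b) ι(σ_b y)` is the single value `ι(y)`. [folklore] -/
private theorem charSum_of_level_one {m : ℕ} [NeZero m] (hm : m = 1) (ι : CyclotomicField m ℚ →+* ℂ)
    (χ : DirichletCharacter ℂ m) (y : CyclotomicField m ℚ) : charSum m ι χ y = ι y := by
  subst hm
  haveI : Subsingleton (ZMod 1) := ZMod.subsingleton_iff.mpr rfl
  haveI : Subsingleton (ZMod 1)ˣ := ⟨fun a b ↦ Units.ext (Subsingleton.elim _ _)⟩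
  rw [charSum, Fintype.sum_subsingleton _ 1, Units.val_one, map_one, one_mul, sigma, map_one,
    AlgEquiv.one_apply]

/-- A Dirichlet character of level `1` is identically `1`. [folklore] -/
private theorem dirichletCharacter_apply_of_level_one {m : ℕ} (hm : m = 1) (χ : DirichletCharacter ℂ m)
    (u : ZMod m) : χ u = 1 := by
  subst hm
  haveI : Subsingleton (ZMod 1) := ZMod.subsingleton_iff.mpr rfl
  rw [Subsingleton.elim u 1, map_one]

end EulerSystemValues

/-! ## §1 The value side (any prime `p`): the bottom class of a guarded zeta family is non-zero -/

section ValueSide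

variable {W : WeierstrassCurve ℚ} [W.IsElliptic] {p : ℕ} [Fact p.Prime]
  [ContinuousSMul ℤ_[p] (W.tateModule p)] [Module.Free ℤ_[p] (W.tateModule p)]
  [Module.Finite ℤ_[p] (W.tateModule p)] {N : ℕ} [NeZero N] {f : CuspForm (Gamma0 N) 2}
  {ι : (m : ℕ) → (CyclotomicField m ℚ →+* ℂ)} {κ' : ℝ}
  {Λ' : ∀ (k : ℕ) (r : Finset (HeightOneSpectrum (𝓞 ℚ))),
    H1 (tateRep W p) (cycSubgroup p k r) →ₗ[ℤ_[p]] ℚ_[p] ⊗[ℚ] CyclotomicField (cycLevel p k r) ℚ}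
  {c d a : ℤ} {A : ℕ}
  {z : ∀ (k : ℕ) (r : (cyclotomicLevelsRat p (badPlaces c d A N)).Ideals),
    H1 (tateRep W p) ((cyclotomicLevelsRat p (badPlaces c d A N)).level k r.1)}
  {x : ∀ (k : ℕ) (r : (cyclotomicLevelsRat p (badPlaces c d A N)).Ideals),
    CyclotomicField (cycLevel p k r.1) ℚ}

omit [NeZero N] in
/-- **Kato's value at the bottom level**: from `ZetaBody` (C4) + (C5) at `k = 0`, `r = ∅`, `χ = 1`:
`Λ_{0,∅}(z_{0,∅}) = 1 ⊗ r₀` with `r₀ ∈ ℚ` and `r₀ = κ · Lχ(1)/Ω⁺_f · R⁻(c,d,a,A,d′)` for every entire continuation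
`Lχ` of the `(pA)`-depleted series (guards `(cd, A) = 1`, `dd′ ≡ 1 (A)`).
[cite: Kato2004Asterisque, Thm. 9.7 (p. 189) and Thm. 6.6 (1) (p. 163)] -/
theorem zetaBody_value_level_one (hbody : ZetaBody W p f ι κ' Λ' c d a A z x) (d' : ℤ)
    (hcd : Int.gcd (c * d) A = 1) (hdd' : d * d' ≡ 1 [ZMOD (A : ℤ)]) {Lχ : ℂ → ℂ}
    (hL : IsDepletedTwistedL f (cycLevel p 0 ∅) (p * A) (1 : DirichletCharacter ℂ (cycLevel p 0 ∅)) Lχ) :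
    ∃ r₀ : ℚ,
      Λ' 0 (cyclotomicLevelsRat p (badPlaces c d A N)).idealOne.1
          (z 0 (cyclotomicLevelsRat p (badPlaces c d A N)).idealOne) =
        (1 : ℚ_[p]) ⊗ₜ[ℚ] algebraMap ℚ _ r₀ ∧
      (r₀ : ℂ) = κ' * (Lχ 1 / (plusPeriod f : ℂ)) * cuspFactor f true (fun _ ↦ 1) c d a A d' := by
  obtain ⟨-, -, -, -, hC4, hC5⟩ := hbody
  have h1 : cycLevel p 0 (cyclotomicLevelsRat p (badPlaces c d A N)).idealOne.1 = 1 :=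
    cycLevel_zero_empty p
  obtain ⟨r₀, hr₀⟩ := exists_algebraMap_eq_of_level_one h1
    (x 0 (cyclotomicLevelsRat p (badPlaces c d A N)).idealOne)
  refine ⟨r₀, ?_, ?_⟩
  · rw [hr₀]
    exact hC4 0 _
  · have hgcd : Int.gcd (c * d)
        (cycLevel p 0 (cyclotomicLevelsRat p (badPlaces c d A N)).idealOne.1 * A) = 1 := by
      rw [h1, Nat.cast_one, one_mul]
      exact hcd
    have h5 := (hC5 0 _ d' 1 Lχ hgcd hdd' hL).1 (by rw [MulChar.one_apply (isUnit_one.neg)])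
    have hχ : (fun n : ℤ ↦
        (1 : DirichletCharacter ℂ (cycLevel p 0 (cyclotomicLevelsRat p (badPlaces c d A N)).idealOne.1))⁻¹
          (n : ZMod _)) = fun _ ↦ (1 : ℂ) := by
      funext n
      rw [inv_one]
      exact dirichletCharacter_apply_of_level_one h1 _ _
    rw [hχ, charSum_of_level_one h1, ← hr₀, ringHom_algebraMap_ratCast] at h5
    exact h5

/-- An entire continuation, NON-ZERO AT `1`, of the `(pA)`-depleted `L`-series of the newform of `W` at the
trivial character of a level `m = 1`, when `L(W,1) ≠ 0` (the removed Euler factors do not vanish at `1`,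
`exists_continuation_changeLevel_of`). [cite: Kato2004Asterisque, §6.2 (p. 161) and §14 (p. 235)] -/
theorem exists_isDepletedTwistedL_one_ne_zero (hf : IsNewformOf W f) (hL1 : W.entireLFunction 1 ≠ 0)
    {m : ℕ} [NeZero m] (hm : m = 1) (M : ℕ) [NeZero M] :
    ∃ L : ℂ → ℂ, IsDepletedTwistedL f m M (1 : DirichletCharacter ℂ m) L ∧ L 1 ≠ 0 := by
  subst hm
  haveI : NeZero (1 * M) := ⟨by rw [one_mul]; exact NeZero.ne M⟩
  obtain ⟨L, hLd, hLs, hL0⟩ := exists_continuation_changeLevel_of (M := 1 * M) hf (dvd_mul_right 1 M)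
    (1 : DirichletCharacter ℂ 1)
    (exists_continuation_twistedLSeries_one_of_entireLFunction_one_ne_zero hf hL1)
  exact ⟨L, ⟨hLd, hLs⟩, hL0⟩

/-- **The bottom class `z_{0,∅} ∈ H¹(ℚ, T_pW)` of Kato's `(c, d, a(A))`-zeta family is NON-ZERO** when
`L(W,1) ≠ 0`, the constant `κ ≠ 0` and the datum carries the VALUE GUARD (`(cd, A) = 1`, `dd′ ≡ 1 (A)`, four-cusp
factor `R⁻ ≠ 0` — satisfiable: `valueGuard_satisfiable`): `Λ_{0,∅}(z_{0,∅}) = 1 ⊗ r₀` with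
`r₀ = κ · L_{(pA)}(f,1)/Ω⁺_f · R⁻ ≠ 0` (`L_{(pA)}(f,1) ≠ 0`, `Ω⁺_f > 0`). Any prime `p`. (Kato Thm. 12.5 (1):
`γ ↦ z_γ` is injective on `V(f)`; here in the tree's value-law currency.)
[cite: Kato2004Asterisque, Thm. 9.7 (p. 189), Thm. 6.6 (1) (p. 163), Thm. 12.5 (1) (pp. 221–222)] -/
theorem zetaBody_bottom_ne_zero (hbody : ZetaBody W p f ι κ' Λ' c d a A z x) (hf : IsNewformOf W f)
    (hκ' : κ' ≠ 0) (hL1 : W.entireLFunction 1 ≠ 0) (hA : 0 < A) (d' : ℤ)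
    (hcd : Int.gcd (c * d) A = 1) (hdd' : d * d' ≡ 1 [ZMOD (A : ℤ)])
    (hR : cuspFactor f true (fun _ ↦ (1 : ℂ)) c d a A d' ≠ 0) :
    z 0 (cyclotomicLevelsRat p (badPlaces c d A N)).idealOne ≠ 0 := by
  haveI : NeZero A := ⟨hA.ne'⟩
  haveI : NeZero (p * A) := ⟨mul_ne_zero (Fact.out : p.Prime).ne_zero hA.ne'⟩
  obtain ⟨Lχ, hLχ, hLχ0⟩ := exists_isDepletedTwistedL_one_ne_zero hf hL1 (cycLevel_zero_empty p) (p * A)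
  obtain ⟨r₀, hΛ, hr₀⟩ := zetaBody_value_level_one hbody d' hcd hdd' hLχ
  have hΩ : (plusPeriod f : ℂ) ≠ 0 := by
    exact_mod_cast (IsNewform0.plusPeriod_pos_holds hf.1 hf.coeffField_eq_bot).ne'
  have hr₀0 : r₀ ≠ 0 := by
    intro h
    rw [h, Rat.cast_zero] at hr₀
    have : (κ' : ℂ) * (Lχ 1 / (plusPeriod f : ℂ)) * cuspFactor f true (fun _ ↦ (1 : ℂ)) c d a A d' ≠ 0 :=
      mul_ne_zero (mul_ne_zero (by exact_mod_cast hκ') (div_ne_zero hLχ0 hΩ)) hR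
    exact this hr₀.symm
  intro hz0
  apply hr₀0
  have h1 : (1 : ℚ_[p]) ⊗ₜ[ℚ] algebraMap ℚ (CyclotomicField (cycLevel p 0
      (cyclotomicLevelsRat p (badPlaces c d A N)).idealOne.1) ℚ) r₀ = 0 := by
    rw [← hΛ, hz0]; exact map_zero _
  have h2 := Algebra.TensorProduct.includeRight_injective (R := ℚ) (A := ℚ_[p])
    (B := CyclotomicField (cycLevel p 0 (cyclotomicLevelsRat p (badPlaces c d A N)).idealOne.1) ℚ)
    (algebraMap ℚ ℚ_[p]).injective
  have h3 : algebraMap ℚ (CyclotomicField (cycLevel p 0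
      (cyclotomicLevelsRat p (badPlaces c d A N)).idealOne.1) ℚ) r₀ = 0 := by
    apply h2
    change (1 : ℚ_[p]) ⊗ₜ[ℚ] (algebraMap ℚ _ r₀) = (1 : ℚ_[p]) ⊗ₜ[ℚ] (0 : CyclotomicField _ ℚ)
    rw [h1, TensorProduct.tmul_zero]
  exact (algebraMap ℚ _).injective (by rw [h3, map_zero])

end ValueSide

/-! ## §2 The Euler-system side: the bottom class controls the Λ-adic lift (odd `p` and `p = 2`) -/

section ESSide

variable (W : WeierstrassCurve ℚ) [W.IsElliptic] (p : ℕ) [Fact p.Prime]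
  [ContinuousSMul ℤ_[p] (W.tateModule p)] [Module.Free ℤ_[p] (W.tateModule p)]
  [Module.Finite ℤ_[p] (W.tateModule p)] {κ : ZpExtension ℚ p}

omit [W.IsElliptic] [ContinuousSMul ℤ_[p] (W.tateModule p)] [Module.Free ℤ_[p] (W.tateModule p)]
  [Module.Finite ℤ_[p] (W.tateModule p)] in
/-- The bottom Euler-system level is the whole Galois group: `Gal(ℚ̄/ℚ(μ_1)) = Γ_ℚ` (Rubin: `F(1) = F`,
here `F = K = ℚ`). [cite: Rubin2000, Def. 2.1.1 and Remark 2.1.4] -/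
theorem cyclotomicLevelsRat_level_zero_empty (S : Set (HeightOneSpectrum (𝓞 ℚ))) :
    (cyclotomicLevelsRat p S).level 0 ∅ = ⊤ :=
  (cyclotomicLevelsRat p S).level_bot_empty

omit [W.IsElliptic] [ContinuousSMul ℤ_[p] (W.tateModule p)] [Module.Free ℤ_[p] (W.tateModule p)]
  [Module.Finite ℤ_[p] (W.tateModule p)] in
/-- `Gal(ℚ̄/ℚ_0) ≤ Gal(ℚ̄/ℚ(μ_1))` (both are `Γ_ℚ`). [folklore] -/
private theorem layerSubgroup_zero_le_level_zero_empty (S : Set (HeightOneSpectrum (𝓞 ℚ))) :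
    κ.layerSubgroup 0 ≤ (cyclotomicLevelsRat p S).level 0 ∅ := by
  rw [cyclotomicLevelsRat_level_zero_empty p S]; exact le_top

/-- **If the bottom class `z_{0,∅}` of an Euler system is non-zero, so is `Cor_{ℚ(μ_{p^k})/ℚ_0}(z_{k,∅})`** for
any level `k` whose field contains `ℚ_0 = ℚ` along a given inclusion `h` — transitivity of corestriction
(`coresLe_comp`) and the `p`-direction norm relation `Cor(z_{k,∅}) = z_{0,∅}` (`IsEulerSystem.cores_p`, no Euler
factor). [cite: Rubin2000, Def. 2.1.1] [cite: Kato2004Asterisque, §13.1 (13.1.1) (p. 224) and §13.8 (p. 228)] -/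
theorem coresLe_level_ne_zero (S : Set (HeightOneSpectrum (𝓞 ℚ))) (k : ℕ)
    (h : (cyclotomicLevelsRat p S).level k ∅ ≤ κ.layerSubgroup 0)
    [Fintype (κ.layerSubgroup 0 ⧸ ((cyclotomicLevelsRat p S).level k ∅).subgroupOf (κ.layerSubgroup 0))]
    {z : ∀ (j : ℕ) (r : (cyclotomicLevelsRat p S).Ideals),
      H1 (tateRep W p) ((cyclotomicLevelsRat p S).level j r.1)}
    (hz : IsEulerSystem (cyclotomicLevelsRat p S) (tateRep W p) p z)
    (h0 : z 0 (cyclotomicLevelsRat p S).idealOne ≠ 0) :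
    coresLe (tateRep W p).toTopRep h ((cyclotomicLevelsRat p S).isOpen_level k ∅)
      (z k (cyclotomicLevelsRat p S).idealOne) ≠ 0 := by
  haveI : ((cyclotomicLevelsRat p S).level k ∅).FiniteIndex :=
    finiteIndex_of_isOpen_of_compactSpace _ ((cyclotomicLevelsRat p S).isOpen_level k ∅)
  haveI : (κ.layerSubgroup 0).FiniteIndex :=
    finiteIndex_of_isOpen_of_compactSpace _ (κ.isOpen_layerSubgroup 0)
  letI : Fintype ((cyclotomicLevelsRat p S).level 0 ∅ ⧸
      (κ.layerSubgroup 0).subgroupOf ((cyclotomicLevelsRat p S).level 0 ∅)) := Fintype.ofFinite _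
  letI : Fintype ((cyclotomicLevelsRat p S).level 0 ∅ ⧸
      ((cyclotomicLevelsRat p S).level k ∅).subgroupOf ((cyclotomicLevelsRat p S).level 0 ∅)) :=
    Fintype.ofFinite _
  have h₂ : κ.layerSubgroup 0 ≤ (cyclotomicLevelsRat p S).level 0 ∅ :=
    layerSubgroup_zero_le_level_zero_empty p S
  have hcomp := LinearMap.congr_fun
    (coresLe_comp (tateRep W p).toTopRep h h₂ ((cyclotomicLevelsRat p S).isOpen_level k ∅)
      (κ.isOpen_layerSubgroup 0)) (z k (cyclotomicLevelsRat p S).idealOne)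
  rw [LinearMap.comp_apply] at hcomp
  have hES := hz.cores_p (Nat.zero_le k) (cyclotomicLevelsRat p S).idealOne
  intro hk
  apply h0
  rw [← hES]
  have step1 : (cyclotomicLevelsRat p S).coresP (tateRep W p) (Nat.zero_le k)
        (cyclotomicLevelsRat p S).idealOne.1 (z k (cyclotomicLevelsRat p S).idealOne) =
      coresLe (tateRep W p).toTopRep (h.trans h₂) ((cyclotomicLevelsRat p S).isOpen_level k ∅)
        (z k (cyclotomicLevelsRat p S).idealOne) := by
    unfold EulerSystemLevels.coresP
    rfl
  rw [step1, ← hcomp, hk, map_zero]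
  rfl

variable (hκ : κ.IsCyclotomic) {γ : absoluteGaloisGroup ℚ} (I : IwasawaH1Data W p κ γ)

/-- **Odd `p`: a Λ-adic class with layer components `Cor_{ℚ(μ_{p^{n+1}})/ℚ_n}(z_{n+1,∅})` is non-zero as soon as
the bottom class `z_{0,∅}` is** (`proj₀ 𝐲 = Cor_{ℚ(μ_p)/ℚ}(z_{1,∅}) = z_{0,∅}`).
[cite: Kato2004Asterisque, §13.1 and Thm. 13.4 (pp. 224–226), §13.8 (p. 228)] -/
theorem lift_ne_zero_of_bottom_ne_zero (hp : p ≠ 2) (S : Set (HeightOneSpectrum (𝓞 ℚ)))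
    {z : ∀ (j : ℕ) (r : (cyclotomicLevelsRat p S).Ideals),
      H1 (tateRep W p) ((cyclotomicLevelsRat p S).level j r.1)}
    (hz : IsEulerSystem (cyclotomicLevelsRat p S) (tateRep W p) p z)
    (h0 : z 0 (cyclotomicLevelsRat p S).idealOne ≠ 0) {y : I.H}
    (hy : ∀ n : ℕ, I.proj n y = levelToLayer W p hκ hp S n (z (n + 1) (cyclotomicLevelsRat p S).idealOne)) :
    y ≠ 0 := by
  haveI : ((cyclotomicLevelsRat p S).level 1 ∅).FiniteIndex :=
    finiteIndex_of_isOpen_of_compactSpace _ ((cyclotomicLevelsRat p S).isOpen_level 1 ∅)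
  letI : Fintype (κ.layerSubgroup 0 ⧸ ((cyclotomicLevelsRat p S).level 1 ∅).subgroupOf (κ.layerSubgroup 0)) :=
    Fintype.ofFinite _
  intro hy0
  have h := hy 0
  rw [hy0, map_zero] at h
  unfold levelToLayer at h
  exact coresLe_level_ne_zero W p S 1 (hκ.cyclotomicLevelsRat_level_succ_le_layerSubgroup hp S 0) hz h0
    h.symm

end ESSide

/-! ## §3 Assembly: hypothesis (i) of Thm. 13.4 discharged, modulo the construction fact -/

section Assembly

variable (W : WeierstrassCurve ℚ) [W.IsElliptic] (p : ℕ) [Fact p.Prime]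
  [ContinuousSMul ℤ_[p] (W.tateModule p)] [Module.Free ℤ_[p] (W.tateModule p)]
  [Module.Finite ℤ_[p] (W.tateModule p)] {κ : ZpExtension ℚ p}
  {γ : absoluteGaloisGroup ℚ} (I : IwasawaH1Data W p κ γ)

omit [W.IsElliptic] [ContinuousSMul ℤ_[p] (W.tateModule p)] [Module.Free ℤ_[p] (W.tateModule p)]
  [Module.Finite ℤ_[p] (W.tateModule p)] in
/-- Admissible guarded data have `2cdAN ≠ 0`: Kato's guards `(c, 6pA) = (d, 6pN) = 1` (Ex. 13.3) with `A, N ≥ 1`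
force `c, d ≠ 0`. [cite: Kato2004Asterisque, Ex. 13.3 (p. 225)] -/
theorem two_mul_natAbs_ne_zero_of_guards {c d : ℤ} {A N : ℕ} (hA : 0 < A) (hN : N ≠ 0)
    (hc : Int.gcd c (6 * p * A) = 1) (hd : Int.gcd d (6 * p * N) = 1) :
    2 * c.natAbs * d.natAbs * A * N ≠ 0 := by
  have hp : 0 < p := (Fact.out : p.Prime).pos
  have h6p : 6 ≤ 6 * p := Nat.le_mul_of_pos_right 6 hp
  have hc0 : c ≠ 0 := by
    rintro rfl
    rw [Int.gcd_zero_left, show (6 * (p : ℤ) * (A : ℤ)) = ((6 * p * A : ℕ) : ℤ) by push_cast; ring,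
      Int.natAbs_natCast] at hc
    have : 6 * p ≤ 6 * p * A := Nat.le_mul_of_pos_right _ hA
    omega
  have hd0 : d ≠ 0 := by
    rintro rfl
    rw [Int.gcd_zero_left, show (6 * (p : ℤ) * (N : ℤ)) = ((6 * p * N : ℕ) : ℤ) by push_cast; ring,
      Int.natAbs_natCast] at hd
    have : 6 * p ≤ 6 * p * N := Nat.le_mul_of_pos_right _ (Nat.pos_of_ne_zero hN)
    omega
  exact mul_ne_zero (mul_ne_zero (mul_ne_zero (mul_ne_zero two_ne_zero (Int.natAbs_ne_zero.mpr hc0))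
    (Int.natAbs_ne_zero.mpr hd0)) hA.ne') hN

/-- **Odd `p`, from a ZetaBody witness**: a guarded `(c, d, a(A))`-zeta family (`κ ≠ 0`, value guard) of the
newform of `W` with `L(W,1) ≠ 0` yields a NON-ZERO genuine Λ-adic Euler-system class in the pinned `𝐇¹_Γ(T_pW)`.
[cite: Kato2004Asterisque, Ex. 13.3 (p. 225), Thm. 12.5 (1) (pp. 221–222), Thm. 13.4 (p. 226)] -/
theorem exists_isEulerSystemClass_ne_zero_of_zetaBody (hκ : κ.IsCyclotomic) (hp : p ≠ 2) {N : ℕ} [NeZero N]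
    {f : CuspForm (Gamma0 N) 2} (hf : IsNewformOf W f) (hL1 : W.entireLFunction 1 ≠ 0)
    {ι : (m : ℕ) → (CyclotomicField m ℚ →+* ℂ)} {κ' : ℝ} (hκ' : κ' ≠ 0)
    {Λ' : ∀ (k : ℕ) (r : Finset (HeightOneSpectrum (𝓞 ℚ))),
      H1 (tateRep W p) (cycSubgroup p k r) →ₗ[ℤ_[p]] ℚ_[p] ⊗[ℚ] CyclotomicField (cycLevel p k r) ℚ}
    {c d a : ℤ} {A : ℕ} (hA : 0 < A) (hc : Int.gcd c (6 * p * A) = 1) (hd : Int.gcd d (6 * p * N) = 1)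
    {d' : ℤ} (hcd : Int.gcd (c * d) A = 1) (hdd' : d * d' ≡ 1 [ZMOD (A : ℤ)])
    (hR : cuspFactor f true (fun _ ↦ (1 : ℂ)) c d a A d' ≠ 0)
    {z : ∀ (k : ℕ) (r : (cyclotomicLevelsRat p (badPlaces c d A N)).Ideals),
      H1 (tateRep W p) ((cyclotomicLevelsRat p (badPlaces c d A N)).level k r.1)}
    {x : ∀ (k : ℕ) (r : (cyclotomicLevelsRat p (badPlaces c d A N)).Ideals),
      CyclotomicField (cycLevel p k r.1) ℚ}
    (hbody : ZetaBody W p f ι κ' Λ' c d a A z x) :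
    ∃ s : I.H, IsEulerSystemClass W p κ γ I s ∧ s ≠ 0 := by
  have hne := two_mul_natAbs_ne_zero_of_guards p hA (NeZero.ne N) hc hd
  obtain ⟨y, hyES, hy⟩ := exists_isEulerSystemClass_of_zetaBody W p hκ hp I f ι κ' Λ' c d a A z x hbody hne
  exact ⟨y, hyES, lift_ne_zero_of_bottom_ne_zero W p hκ I hp (badPlaces c d A N) hbody.1
    (zetaBody_bottom_ne_zero hbody hf hκ' hL1 hA d' hcd hdd' hR) hy⟩

/-- **Hypothesis (i) of Kato Thm. 13.4, DISCHARGED for odd `p` modulo the construction fact.** For every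
elliptic `W/ℚ` with `W[p]` irreducible (`p` odd), newform `f`, `L(W,1) ≠ 0`, the cyclotomic `κ` and every pinned
`I : IwasawaH1Data W p κ γ`: GRANTED `exists_eulerSystem_expStar_values` (Kato (8.1.3)/Ex. 13.3 with Thm. 9.7 and
Thm. 6.6 (1)), there is `s ∈ 𝐇¹_Γ(T_pW)` with `IsEulerSystemClass W p κ γ I s` and `s ≠ 0` — an admissible guarded
datum exists (`valueGuard_satisfiable`), its zeta family lifts (`exists_isEulerSystemClass_of_zetaBody`) and the
lift is non-zero (`zetaBody_bottom_ne_zero`, `lift_ne_zero_of_bottom_ne_zero`). Discharges the binder `hES` of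
`fineSelmerDual_isTorsion_of_thm13_4_of_thm12_4_of_exists_isEulerSystemClass`.
[cite: Kato2004Asterisque, Ex. 13.3 (p. 225), Thm. 12.5 (1) (pp. 221–222), Thm. 13.4 (p. 226), 13.9 (p. 229)] -/
theorem exists_isEulerSystemClass_ne_zero (hκ : κ.IsCyclotomic) (hES : exists_eulerSystem_expStar_values) (hp : p ≠ 2)
    (hirr : W.HasIrreducibleModPGaloisRep p) {N : ℕ} [NeZero N] (f : CuspForm (Gamma0 N) 2)
    (hf : IsNewformOf W f) (hL1 : W.entireLFunction 1 ≠ 0) :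
    ∃ s : I.H, IsEulerSystemClass W p κ γ I s ∧ s ≠ 0 := by
  set ι : (m : ℕ) → (CyclotomicField m ℚ →+* ℂ) :=
    fun m ↦ Classical.choice (inferInstance : Nonempty (CyclotomicField m ℚ →+* ℂ)) with hι
  obtain ⟨κ', hκ'0, Λ', hfam⟩ := hES W p hirr f hf ι
  obtain ⟨c, d, a, A, d', hA, hc, hd, hcd, hdd', hR⟩ := valueGuard_satisfiable f hf.1 hf.coeffField_eq_bot p
  obtain ⟨z, x, hbody⟩ := hfam c d a A hA hc hd
  exact exists_isEulerSystemClass_ne_zero_of_zetaBody W p I hκ hp hf hL1 hκ'0 hA hc hd hcd hdd' hR hbody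

end Assembly

end Literature.NumberTheory.EllipticCurves.Kato2004

end
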